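import Summits.HodgeConjecture.HodgeConjecture.Theorems.EightfoldBlochSeedsBlochSeedsGenericKleimanSmoothFormSuffices
import Literature.AlgebraicGeometry.HodgeTheory.KleimanChernNormalForm
import Literature.AlgebraicGeometry.HodgeTheory.TwistNormalisedChernCharacter
import HarnessLib

/-!
# Route `EightfoldBlochSeeds`, cruxes `BlochSeedsGeneric` (stmt-HodgeConjecture-18880) / `BlochSeedDiscThree` (18882), stub
# `stub_pad4_carrier`: the named fact (K) `kleiman1969_smoothingCycles_eightfold_codimFour` ASSEMBLED from the census debts —
# a Chern character `C : ChernCharacterBetti` (item 19780) in Kleiman's normal form (`C.KleimanChernNormalForm`, the EXISTING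
# predicate shared with route `KleimanBFSeeds`) and ONE geometric statement about `C` (Kleiman–Bertini degeneracy loci +
# Fulton–Lazarsfeld connectedness, written inline as a hypothesis shape)

HONEST FRAMING. CONDITIONAL `--supports` helpers (leafhand `leafhand-hodge-eightfoldblochseed-1-g4`). Nothing here proves the stub,
(K), the crux, item 19780, rung H2, HC_AV or HC; no definition, no new named fact (D-0026): the geometric statement is a HYPOTHESIS
SHAPE written inline (a `variable`), exactly as the smooth form was in `…KleimanSmoothFormSuffices`. No Chern character is
constructed: `C` is a PARAMETER.

WHAT. The census of the carrier stubs (hands 1-g3 / 3-g2, `CENSUS-K5-leafhand-1-g3.md`) lists the residual of (K) as K1 Chern classes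
of algebraic bundles in `complexBetti` (= an instance `C : ChernCharacterBetti`, item 19780 `ChernCharacterOnBetti`), K2 Kleiman's
normal form (Fulton Ex. 15.3.2: `3!·y = c₄(E) − n·h⁴`, typed in the tree as `ChernCharacterBetti.KleimanChernNormalForm C` through the
Chern CHARACTER: `ch₄(E) = q·h⁴ + N·y`, `N ≠ 0`, `chᵢ(E) = cᵢ·hⁱ` for `0 < i < 4`), K3 Kleiman–Bertini / Thom–Porteous for the
degeneracy locus of general sections (smooth of relative dimension `4`, carrying `c₄`), K4 Fulton–Lazarsfeld (connected). This file
makes that list a KERNEL-CHECKED SUFFICIENCY STATEMENT: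

* §1 `kleiman1969_smoothingCycles_eightfold_codimFour_iff_one` — the multiplicity `M` of (K) is idle: (K) is equivalent to its
  `M = 1` form (the supported classes `classesSupportedOn X Z 8` form a `ℂ`-submodule, so `M·y + c·h⁴` supported ⟹
  `y + (c/M)·h⁴` supported). Unconditional.
* §2 THE SHAPE K34(`C`) (hypothesis `hKB`, verbatim below): on a smooth projective eightfold `X ⊆ ℙᴺ` with `h = e^*a` (`a ≠ 0`
  rational), for every finite locally free `E` whose low Chern character is in normal form (`chᵢ(E) = cᵢ·hⁱ`, `0 < i < 4`) there
  are `ρ ∈ ℚ` and a closed subscheme `Z ↪ X`, SMOOTH OF RELATIVE DIMENSION `4` over `ℂ` and CONNECTED, on which `ch₄(E) + ρ·h⁴` is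
  supported. Why this is the printed geometry for the intended instance `C = cl ∘ ch`: by Newton's formula `c₄(E) = −6·ch₄(E) +
  r·h⁴` under the normal form (Fulton Ex. 3.2.3), and `c₄(E(m)) = c₄(E) + r'·h⁴`; for `m ≫ 0`, `E(m−1)` is generated by its
  sections (Serre), so the degeneracy locus `D` of `rk E − 3` general sections of `E(m)` is empty or smooth of pure codimension `4`
  (Kleiman–Bertini in characteristic `0`: the deeper stratum has codimension `10 > 8`; Fulton Ex. 14.3.2 (d), Kleiman 1974), its class
  is `c₄(E(m))` and is supported on it (Thom–Porteous, Fulton Thm. 14.4 and §19.1), and it is connected when non-empty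
  (Fulton–Lazarsfeld Thm. 1.1 (b): `E(m)` ample, `8 > 4`); when `c₄(E(m)) = 0` (e.g. `rk E ≤ 3`) the class `ch₄(E) + ρ·h⁴` is, for
  a suitable `ρ`, a rational multiple of `h⁴`, supported on a smooth connected linear section of codimension `4` (Bertini). So
  K34(`cl ∘ ch`) = K3 + K4 of the census (with Serre's theorem and Bertini), and NOTHING ELSE of Kleiman's paper is used.
* §3 `kleimanSmoothForm_of_chernNormalForm_of_degeneracyLoci` — `C.KleimanChernNormalForm ∧ K34(C) ⟹` the SMOOTH FORM of (K)
  (1-g3's hypothesis shape, verbatim), hence (K) itself (`kleiman1969_smoothingCycles_eightfold_codimFour_of_chernNormalForm_of_degeneracyLoci`,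
  via `kleiman1969_smoothingCycles_eightfold_codimFour_of_smoothForm`, EGA IV 17.12.1 already discharged), hence the registered carrier
  stubs of 18880 (every `d`) and 18882 (`d = 3`) IN THEIR OWN SIGNATURES (`stub_pad4_carrier_of_chernNormalForm_of_degeneracyLoci`,
  `stub_pad4_carrier_discThree_of_chernNormalForm_of_degeneracyLoci`). Proof of §3: the normal form gives `E` with
  `ch₄(E) = q·h⁴ + N·y`, `N ≠ 0`; K34 gives `Z` with `ch₄(E) + ρ·h⁴ = N·y + (q + ρ)·h⁴` supported on `Z`; divide by `N`.

EXACT RESIDUAL of the carrier stubs after this file (census, by name): an instance `C : ChernCharacterBetti` (item 19780) WITH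
`C.KleimanChernNormalForm` (Fulton Ex. 15.3.2, class level; shared debt of route `KleimanBFSeeds`) AND K34(`C`) (Serre + Kleiman–Bertini
+ Thom–Porteous + Fulton–Lazarsfeld at `(dim, codim) = (8, 4)`). The RUNG `stub_rung_pad4_seedAt` (Bloch semiregularity) is untouched.

References: [cite: Kleiman1969Grassmannians, §4–§5] [cite: Fulton1998, Example 3.2.3, Example 15.3.2, Example 14.3.2 (d), Thm. 14.4,
Example 14.4.13 and §19.1] [cite: FultonLazarsfeld1981, Thm. 1.1 (b)] [cite: Bloch1972Semiregularity, Remark (7.5)]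
-/

noncomputable section

-- single-problem summit (Problem = Summit): the mandated namespace repeats `HodgeConjecture`.
set_option linter.dupNamespace false

open CategoryTheory AlgebraicGeometry
open Literature.AlgebraicGeometry Literature.AlgebraicGeometry.Motives Literature.AlgebraicGeometry.HodgeTheory
open Literature.AlgebraicTopology.SingularHomology
open Summit.HodgeConjecture.HodgeConjecture.Theorems.EightfoldBlochSeeds

namespace Summit.HodgeConjecture.HodgeConjecture.Theorems

/-! ## §1 The multiplicity of (K) is idle -/

/-- **(K) is equivalent to its `M = 1` form.** In `kleiman1969_smoothingCycles_eightfold_codimFour` the conclusion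
«`M·y + c·h⁴` is supported on `Z` for some `M ≥ 1`, `c ∈ ℚ`» may be replaced by «`y + c·h⁴` is supported on `Z` for some `c ∈ ℚ`»:
the classes supported on `Z` form a `ℂ`-submodule (`classesSupportedOn` is a kernel), so one divides by `M`.
[cite: GrothendieckTopology1969, §1] [cite: Fulton1998, Example 15.3.2] -/
theorem kleiman1969_smoothingCycles_eightfold_codimFour_iff_one :
    kleiman1969_smoothingCycles_eightfold_codimFour ↔
      ∀ (X : Motives.SchemeOver ℂ), Motives.IsSmoothProjective 8 X →
        ∀ (e : Motives.ProjectiveEmbedding X) (a : complexBetti (Motives.projectiveSpace e.n ℂ) 2),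
          IsRationalClass a → a ≠ 0 →
        ∀ (y : complexBetti X (2 * 4)), IsRationalClass y → y ∈ algebraicClasses X 4 →
          ∃ (c : ℚ) (Z : AlgebraicGeometry.Scheme.{0}) (i : Z ⟶ X.left),
            IsRegularImmersionOfCodim i 4 ∧ AlgebraicGeometry.Smooth (i ≫ X.hom) ∧ ConnectedSpace Z ∧
            y + ((c : ℚ) : ℂ) • cupPowTwo (complexBetti.map e.ι 2 a) 4 ∈
              classesSupportedOn X (Set.range i.base) (2 * 4) := by
  constructor
  · intro hK X hX e a ha ha0 y hy hyalg
    obtain ⟨M, c, Z, i, hM, hreg, hsm, hconn, hsupp⟩ := hK X hX e a ha ha0 y hy hyalg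
    refine ⟨c / M, Z, i, hreg, hsm, hconn, ?_⟩
    have hM' : ((M : ℕ) : ℂ) ≠ 0 := by exact_mod_cast hM.ne'
    have key : y + (((c / M : ℚ)) : ℂ) • cupPowTwo (complexBetti.map e.ι 2 a) 4 =
        ((M : ℕ) : ℂ)⁻¹ • (((M : ℕ) : ℂ) • y + ((c : ℚ) : ℂ) • cupPowTwo (complexBetti.map e.ι 2 a) 4) := by
      rw [smul_add, smul_smul, inv_mul_cancel₀ hM', one_smul, smul_smul]
      push_cast
      rw [div_eq_inv_mul]
    rw [key]
    exact Submodule.smul_mem _ _ hsupp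
  · intro hK X hX e a ha ha0 y hy hyalg
    obtain ⟨c, Z, i, hreg, hsm, hconn, hsupp⟩ := hK X hX e a ha ha0 y hy hyalg
    refine ⟨1, c, Z, i, Nat.one_pos, hreg, hsm, hconn, ?_⟩
    simpa only [Nat.cast_one, one_smul] using hsupp

/-! ## §2–§3 (K) from a Chern character in Kleiman's normal form and the degeneracy-locus shape K34 -/

section Assembly

variable (C : ChernCharacterBetti)

/- THE SHAPE K34(`C`) (hypothesis of this section): Kleiman–Bertini + Thom–Porteous + Fulton–Lazarsfeld (with Serre and Bertini) on
a smooth projective eightfold in codimension four, read through the Chern character `C` — for a finite locally free `E` with low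
Chern character in normal form with respect to `h = e^*a`, some `ch₄(E) + ρ·h⁴` (`ρ ∈ ℚ`) is supported on a closed subscheme smooth
of relative dimension `4` over `ℂ` and connected. -/
variable (hKB : ∀ (X : Motives.SchemeOver ℂ), Motives.IsSmoothProjective 8 X →
    ∀ (e : Motives.ProjectiveEmbedding X) (a : complexBetti (Motives.projectiveSpace e.n ℂ) 2),
      IsRationalClass a → a ≠ 0 →
    ∀ (E : X.left.Modules), Motives.IsFiniteLocallyFree E →
      ∀ (c : ℕ → ℚ), (∀ i : ℕ, 0 < i → i < 4 →
          C.ch X E i = ((c i : ℚ) : ℂ) • cupPowTwo (complexBetti.map e.ι 2 a) i) →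
      ∃ (ρ : ℚ) (Z : AlgebraicGeometry.Scheme.{0}) (i : Z ⟶ X.left),
        IsClosedImmersion i ∧ AlgebraicGeometry.SmoothOfRelativeDimension 4 (i ≫ X.hom) ∧ ConnectedSpace Z ∧
        C.ch X E 4 + ((ρ : ℚ) : ℂ) • cupPowTwo (complexBetti.map e.ι 2 a) 4 ∈
          classesSupportedOn X (Set.range i.base) (2 * 4))

include hKB

/-- **Kleiman's normal form ∧ K34 ⟹ the SMOOTH FORM of (K)** (1-g3's hypothesis shape of
`kleiman1969_smoothingCycles_eightfold_codimFour_of_smoothForm`, verbatim, with `M = 1`): for a rational algebraic `y` of codimension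
`4` on the smooth projective eightfold `X`, the normal form supplies a finite locally free `E` with `ch₄(E) = q·h⁴ + N·y` (`N ≠ 0`) and
`chᵢ(E) = cᵢ·hⁱ` (`0 < i < 4`); K34 supplies `ρ` and a smooth connected `Z` of relative dimension `4` supporting
`ch₄(E) + ρ·h⁴ = N·y + (q + ρ)·h⁴`; dividing by `N` in the submodule of classes supported on `Z` gives `y + ((q + ρ)/N)·h⁴`.
[cite: Fulton1998, Example 15.3.2 and Example 14.3.2 (d)] [cite: FultonLazarsfeld1981, Thm. 1.1 (b)] [cite: Kleiman1969Grassmannians, §5] -/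
theorem kleimanSmoothForm_of_chernNormalForm_of_degeneracyLoci (hC : C.KleimanChernNormalForm) :
    ∀ (X : Motives.SchemeOver ℂ), Motives.IsSmoothProjective 8 X →
    ∀ (e : Motives.ProjectiveEmbedding X) (a : complexBetti (Motives.projectiveSpace e.n ℂ) 2),
      IsRationalClass a → a ≠ 0 →
    ∀ (y : complexBetti X (2 * 4)), IsRationalClass y → y ∈ algebraicClasses X 4 →
      ∃ (M : ℕ) (c : ℚ) (Z : AlgebraicGeometry.Scheme.{0}) (i : Z ⟶ X.left),
        0 < M ∧ IsClosedImmersion i ∧ AlgebraicGeometry.SmoothOfRelativeDimension 4 (i ≫ X.hom) ∧ ConnectedSpace Z ∧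
        ((M : ℕ) : ℂ) • y + ((c : ℚ) : ℂ) • cupPowTwo (complexBetti.map e.ι 2 a) 4 ∈
          classesSupportedOn X (Set.range i.base) (2 * 4) := by
  intro X hX e a ha ha0 y hy hyalg
  obtain ⟨E, hE, q, N, c, hN, hch4, hlow⟩ := hC hX e a ha ha0 (p := 4) (by norm_num) hy hyalg
  obtain ⟨ρ, Z, i, hci, hsm, hconn, hsupp⟩ := hKB X hX e a ha ha0 E hE c hlow
  refine ⟨1, (q + ρ) / N, Z, i, Nat.one_pos, hci, hsm, hconn, ?_⟩
  have hN' : ((N : ℚ) : ℂ) ≠ 0 := by exact_mod_cast hN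
  set h4 := cupPowTwo (complexBetti.map e.ι 2 a) 4 with hh4
  have key : (((1 : ℕ) : ℕ) : ℂ) • y + ((((q + ρ) / N : ℚ)) : ℂ) • h4 =
      ((N : ℚ) : ℂ)⁻¹ • (C.ch X E 4 + ((ρ : ℚ) : ℂ) • h4) := by
    rw [hch4, smul_add, smul_add, smul_smul, smul_smul, smul_smul, inv_mul_cancel₀ hN', one_smul]
    push_cast
    rw [one_smul]
    module
  rw [key]
  exact Submodule.smul_mem _ _ hsupp

/-- **(K) `kleiman1969_smoothingCycles_eightfold_codimFour` from a Chern character in Kleiman's normal form and the shape K34**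
(§3 composed with 1-g3's `kleiman1969_smoothingCycles_eightfold_codimFour_of_smoothForm`: the local-complete-intersection clause is
EGA IV 17.12.1, a tree theorem). [cite: Kleiman1969Grassmannians, §4–§5] [cite: Fulton1998, Example 15.3.2] [cite: EGAIV4, Prop. 17.12.1] -/
theorem kleiman1969_smoothingCycles_eightfold_codimFour_of_chernNormalForm_of_degeneracyLoci
    (hC : C.KleimanChernNormalForm) : kleiman1969_smoothingCycles_eightfold_codimFour :=
  kleiman1969_smoothingCycles_eightfold_codimFour_of_smoothForm
    (kleimanSmoothForm_of_chernNormalForm_of_degeneracyLoci C hKB hC)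

/-- **`stub_pad4_carrier` of crux `BlochSeedsGeneric` (item 18880; every `d ≥ 1`, every CM datum) MODULO a Chern character in
Kleiman's normal form and the shape K34**, in the stub's own signature. [cite: Kleiman1969Grassmannians, §5]
[cite: Fulton1998, Example 15.3.2] [cite: Bloch1972Semiregularity, Remark (7.5)] -/
theorem stub_pad4_carrier_of_chernNormalForm_of_degeneracyLoci (hC : C.KleimanChernNormalForm)
    (d : ℕ) (hd : 0 < d) (E₀ : AbelianVariety ℂ) (ψ₀ : E₀ ⟶ E₀) (hE : E₀.dim = 1) (hψ : ψ₀ ≫ ψ₀ = -(d • 𝟙 E₀)) :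
    ∃ (e : ProjectiveEmbedding (pad4Anchor E₀).X) (a : complexBetti (projectiveSpace e.n ℂ) 2)
      (w : complexBetti (pad4Anchor E₀).X (2 * 4)),
      IsRationalClass a ∧ a ≠ 0 ∧
      w ∈ weilClassesOf (pad4Anchor E₀) (pad4Action E₀ ψ₀) 4 d ∧ IsRationalClass w ∧ w ≠ 0 ∧
      HasLciCarrierAt 4 (pad4Anchor E₀) (symH d (pad4Action E₀ ψ₀) e a) w :=
  stub_pad4_carrier_of_kleimanSmoothing
    (kleiman1969_smoothingCycles_eightfold_codimFour_of_chernNormalForm_of_degeneracyLoci C hKB hC) d hd E₀ ψ₀ hE hψ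

/-- **`stub_pad4_carrier` of crux `BlochSeedDiscThree` (item 18882, `d = 3`) MODULO a Chern character in Kleiman's normal form and
the shape K34**, in that stub's own signature. [cite: Kleiman1969Grassmannians, §5] [cite: Schoen1998HodgeWeilAddendum, §10] -/
theorem stub_pad4_carrier_discThree_of_chernNormalForm_of_degeneracyLoci (hC : C.KleimanChernNormalForm)
    (E₀ : AbelianVariety ℂ) (ψ₀ : E₀ ⟶ E₀) (hE : E₀.dim = 1) (hψ : ψ₀ ≫ ψ₀ = -(3 • 𝟙 E₀)) :
    ∃ (e : ProjectiveEmbedding (pad4Anchor E₀).X) (a : complexBetti (projectiveSpace e.n ℂ) 2)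
      (w : complexBetti (pad4Anchor E₀).X (2 * 4)),
      IsRationalClass a ∧ a ≠ 0 ∧
      w ∈ weilClassesOf (pad4Anchor E₀) (pad4Action E₀ ψ₀) 4 3 ∧ IsRationalClass w ∧ w ≠ 0 ∧
      HasLciCarrierAt 4 (pad4Anchor E₀) (symH 3 (pad4Action E₀ ψ₀) e a) w :=
  stub_pad4_carrier_discThree_of_kleimanSmoothing
    (kleiman1969_smoothingCycles_eightfold_codimFour_of_chernNormalForm_of_degeneracyLoci C hKB hC) E₀ ψ₀ hE hψ

end Assembly

/-! ## §4 (appended, same hand) The residual BY NAME: item 19780's Chern character + Fulton's presentation fact + K34 -/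

section ByName

variable (C : ChernCharacterBetti)

/- The shape K34(`C`) again (section-local hypothesis, verbatim §2). -/
variable (hKB : ∀ (X : Motives.SchemeOver ℂ), Motives.IsSmoothProjective 8 X →
    ∀ (e : Motives.ProjectiveEmbedding X) (a : complexBetti (Motives.projectiveSpace e.n ℂ) 2),
      IsRationalClass a → a ≠ 0 →
    ∀ (E : X.left.Modules), Motives.IsFiniteLocallyFree E →
      ∀ (c : ℕ → ℚ), (∀ i : ℕ, 0 < i → i < 4 →
          C.ch X E i = ((c i : ℚ) : ℂ) • cupPowTwo (complexBetti.map e.ι 2 a) i) →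
      ∃ (ρ : ℚ) (Z : AlgebraicGeometry.Scheme.{0}) (i : Z ⟶ X.left),
        IsClosedImmersion i ∧ AlgebraicGeometry.SmoothOfRelativeDimension 4 (i ≫ X.hom) ∧ ConnectedSpace Z ∧
        C.ch X E 4 + ((ρ : ℚ) : ℂ) • cupPowTwo (complexBetti.map e.ι 2 a) 4 ∈
          classesSupportedOn X (Set.range i.base) (2 * 4))

include hKB

/-- **(K) from ANY Chern character `C` (a witness of item 19780 `ChernCharacterOnBetti = Nonempty ChernCharacterBetti`), Fulton's
presentation fact and K34(`C`).** Kleiman's normal form holds for every `C` granted the tree's named fact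
`KTheory.Fulton1998_chernCharacter_presentsAlgebraicClasses` (`ChernCharacterBetti.kleimanChernNormalForm_of_presentsAlgebraicClasses`,
Fulton Ex. 15.2.16 (b) + 15.3.2), so §3 reads: EXACT RESIDUAL of (K) BY NAME = a term `C : ChernCharacterBetti` (item 19780) + the
EXISTING named fact `Fulton1998_chernCharacter_presentsAlgebraicClasses` + K34(`C`) (Serre + Kleiman–Bertini ∕ Thom–Porteous +
Fulton–Lazarsfeld at `(8, 4)`, read through `C`). [cite: Fulton1998, Example 15.2.16 (b) and Example 15.3.2]
[cite: Kleiman1969Grassmannians, §4–§5] [cite: FultonLazarsfeld1981, Thm. 1.1 (b)] -/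
theorem kleiman1969_smoothingCycles_eightfold_codimFour_of_presentsAlgebraicClasses_of_degeneracyLoci
    (hF : KTheory.Fulton1998_chernCharacter_presentsAlgebraicClasses) :
    kleiman1969_smoothingCycles_eightfold_codimFour :=
  kleiman1969_smoothingCycles_eightfold_codimFour_of_chernNormalForm_of_degeneracyLoci C hKB
    (C.kleimanChernNormalForm_of_presentsAlgebraicClasses hF)

/-- **`stub_pad4_carrier` of crux `BlochSeedsGeneric` (item 18880; every `d ≥ 1`) MODULO item 19780's `C`, Fulton's presentation fact
and K34(`C`)**, in the stub's own signature. [cite: Kleiman1969Grassmannians, §5] [cite: Fulton1998, Example 15.3.2]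
[cite: Bloch1972Semiregularity, Remark (7.5)] -/
theorem stub_pad4_carrier_of_presentsAlgebraicClasses_of_degeneracyLoci
    (hF : KTheory.Fulton1998_chernCharacter_presentsAlgebraicClasses)
    (d : ℕ) (hd : 0 < d) (E₀ : AbelianVariety ℂ) (ψ₀ : E₀ ⟶ E₀) (hE : E₀.dim = 1) (hψ : ψ₀ ≫ ψ₀ = -(d • 𝟙 E₀)) :
    ∃ (e : ProjectiveEmbedding (pad4Anchor E₀).X) (a : complexBetti (projectiveSpace e.n ℂ) 2)
      (w : complexBetti (pad4Anchor E₀).X (2 * 4)),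
      IsRationalClass a ∧ a ≠ 0 ∧
      w ∈ weilClassesOf (pad4Anchor E₀) (pad4Action E₀ ψ₀) 4 d ∧ IsRationalClass w ∧ w ≠ 0 ∧
      HasLciCarrierAt 4 (pad4Anchor E₀) (symH d (pad4Action E₀ ψ₀) e a) w :=
  stub_pad4_carrier_of_chernNormalForm_of_degeneracyLoci C hKB (C.kleimanChernNormalForm_of_presentsAlgebraicClasses hF)
    d hd E₀ ψ₀ hE hψ

/-- **`stub_pad4_carrier` of crux `BlochSeedDiscThree` (item 18882, `d = 3`) MODULO item 19780's `C`, Fulton's presentation fact and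
K34(`C`)**, in that stub's own signature. [cite: Kleiman1969Grassmannians, §5] [cite: Schoen1998HodgeWeilAddendum, §10] -/
theorem stub_pad4_carrier_discThree_of_presentsAlgebraicClasses_of_degeneracyLoci
    (hF : KTheory.Fulton1998_chernCharacter_presentsAlgebraicClasses)
    (E₀ : AbelianVariety ℂ) (ψ₀ : E₀ ⟶ E₀) (hE : E₀.dim = 1) (hψ : ψ₀ ≫ ψ₀ = -(3 • 𝟙 E₀)) :
    ∃ (e : ProjectiveEmbedding (pad4Anchor E₀).X) (a : complexBetti (projectiveSpace e.n ℂ) 2)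
      (w : complexBetti (pad4Anchor E₀).X (2 * 4)),
      IsRationalClass a ∧ a ≠ 0 ∧
      w ∈ weilClassesOf (pad4Anchor E₀) (pad4Action E₀ ψ₀) 4 3 ∧ IsRationalClass w ∧ w ≠ 0 ∧
      HasLciCarrierAt 4 (pad4Anchor E₀) (symH 3 (pad4Action E₀ ψ₀) e a) w :=
  stub_pad4_carrier_discThree_of_chernNormalForm_of_degeneracyLoci C hKB
    (C.kleimanChernNormalForm_of_presentsAlgebraicClasses hF) E₀ ψ₀ hE hψ

end ByName

/-! ## §5 (appended, same hand) Honesty about the cut: K34 in (K)'s own clauses is IMPLIED by (K), for every `C` -/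

/-- **(K) ⟹ the degeneracy-locus shape in (K)'s clauses, for EVERY Chern character `C`** (no normal form needed): `ch₄(E)` of a
finite locally free `E` on a smooth projective eightfold is a rational (`isRationalClass_ch`) algebraic (`ch_mem_algebraicClasses`)
class, so (K) in its `M = 1` form (§1) applies to `y := ch₄(E)`. Hence, read through an ABSTRACT `C`, the shape K34 of §2 differs
from (K) restricted to Chern classes only by its smooth-form clauses («closed immersion, smooth of relative dimension `4`» instead
of «regular immersion of codimension `4`, smooth»): the cut (K) = normal form + K34 is a factorisation of the PROOF (Fulton Ex. 15.3.2,
then Kleiman–Bertini ∕ Thom–Porteous ∕ Fulton–Lazarsfeld on the bundle), not a weakening of the statement — recorded so that no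
planner files K34 as an item «smaller than (K)». [cite: Fulton1998, Example 15.3.2 and Prop. 19.1.2] [cite: Kleiman1969Grassmannians, §5] -/
theorem degeneracyLociShape_of_kleiman1969_smoothingCycles_eightfold_codimFour
    (hK : kleiman1969_smoothingCycles_eightfold_codimFour) (C : ChernCharacterBetti) :
    ∀ (X : Motives.SchemeOver ℂ), Motives.IsSmoothProjective 8 X →
    ∀ (e : Motives.ProjectiveEmbedding X) (a : complexBetti (Motives.projectiveSpace e.n ℂ) 2),
      IsRationalClass a → a ≠ 0 →
    ∀ (E : X.left.Modules), Motives.IsFiniteLocallyFree E →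
      ∃ (ρ : ℚ) (Z : AlgebraicGeometry.Scheme.{0}) (i : Z ⟶ X.left),
        IsRegularImmersionOfCodim i 4 ∧ AlgebraicGeometry.Smooth (i ≫ X.hom) ∧ ConnectedSpace Z ∧
        C.ch X E 4 + ((ρ : ℚ) : ℂ) • cupPowTwo (complexBetti.map e.ι 2 a) 4 ∈
          classesSupportedOn X (Set.range i.base) (2 * 4) := by
  intro X hX e a ha ha0 E hE
  exact kleiman1969_smoothingCycles_eightfold_codimFour_iff_one.1 hK X hX e a ha ha0 (C.ch X E 4)
    (C.isRationalClass_ch X E hE.isVectorBundle 4) (C.ch_mem_algebraicClasses hX E hE.isVectorBundle 4)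

end Summit.HodgeConjecture.HodgeConjecture.Theorems

end
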